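import Summits.ResolutionOfSingularities.ResolutionOfSingularities.Theorems.HilbertSamuelEliminationSigmaMaxModificationsCorridor3WLadderStrataClean
import HarnessLib

/-!
# [OURS · L1 W4.2] The STRATA-half of the MOVING W-ladder, ninth layer (part 1): a component of `X_{n+1}(ν)` DOMINATING a
# component `Z ⊄ V(C)` of `X_n(ν)` IS the strict transform of `Z` — the UNIQUENESS half of kernel (K-str), PROVED

Crux chain w42 (`SigmaMaxModifications`, stmt-ResolutionOfSingularities-18506; skeleton `w_ladder` v6/v7 on
`SigmaMaxModificationsCorridor3`, stmt-ResolutionOfSingularities-19249), row «stub-4 → `Moving.Wlow3CharStrataM p`», kernel (K-str)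
`StrataStrictTransformClean` (p516588), seat res-L1-w42-stub-4 (gen 4). OURS (cell res-hironaka, slot W4.2); NOT statements of
H. Hironaka's manuscript [Hironaka2017] nor of [CossartJannsenSaito2020]; AI-drafted, weaker than expert review. Pure proofs (no
definitions). Helper file `--supports stmt-ResolutionOfSingularities-19249`.

## What is proved

* `StepProjection.eq_strictTransformSet_of_closure_image_eq` — under the cycle invariant, along a step projection
  `f : X_{n+1} ⟶ X_n` with canonical centre `C`: an irreducible component `Z'` of `X_{n+1}(ν)` whose image closure is an irreducible
  component `Z` of `X_n(ν)` NOT contained in `V(C)` equals the strict transform `closure f⁻¹(Z ∖ V(C))` of `Z` (off the centre the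
  blow-down is an isomorphism preserving `H^N`, GW Prop. 13.91 (3); the argument of p505314 §1 run for a dominating component).
* `StepProjection.dominant_unique` — hence two such components coincide: the UNIQUENESS clause of (K-str) holds outright (no
  regularity needed), `strataStrictTransformClean_uniqueness`.

References: Görtz–Wedhorn I Prop. 13.91 (3), (13.19) [GortzWedhorn2020]; CJS LNM 2270 Rem. 6.29 (1) [CossartJannsenSaito2020]; tree
`…CampaignW42TertiaryStrictTransformParts` (`isIrreducible_strictTransformSet_of_not_subset`, `exists_componentsIn_superset`),
`…TertiaryInStratum` (`strictTransformSet_subset_hsStratum`), p504439 (`CycleInv`), p500484 (`StepProjection`).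
-/

noncomputable section

-- plan-1/idea-2 module setting kept (namespace `…Corridor3.Moving` re-enters `…Corridor3`)
set_option linter.dupNamespace false

open CategoryTheory AlgebraicGeometry TopologicalSpace Topology IsLocalRing
open Summit.ResolutionOfSingularities.ResolutionOfSingularities.Theorems.CampaignW42
open Literature.AlgebraicGeometry.Resolution Literature.RingTheory.HilbertSamuel
open Literature.AlgebraicGeometry.CossartJannsenSaito2020
open Summit.ResolutionOfSingularities.ResolutionOfSingularities.Theorems.SigmaMaxModificationsCorridor3

universe u

namespace Summit.ResolutionOfSingularities.ResolutionOfSingularities.Theorems.SigmaMaxModificationsCorridor3.Moving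

variable {R : ∀ S : Scheme.{u}, CentreSeq S → Prop} {N : ℕ} {ν : ℕ → ℕ}

/-! ## §1. A dominating component off the centre is the strict transform -/

/-- **On the chosen blow-up** of a Noetherian `W` in `C` (with the `ν`-stratum upstairs closed): an irreducible component `Z'` of
`Bl_C(W)(ν)` whose image closure is an irreducible component `Z ⊄ V(C)` of `W(ν)` IS the strict transform `closure π⁻¹(Z ∖ V(C))`.
[cite: GortzWedhorn2020, Prop. 13.91 (3), (13.19) p. 414] -/
theorem eq_strictTransformSet_blowup {W : Scheme.{u}} [IsNoetherian W] (C : W.IdealSheafData) [IsNoetherian (blowup C)]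
    (hY' : IsClosed (Scheme.hsStratum (blowup C) N ν))
    {Z : Set W} (hZ : Z ∈ componentsIn (Scheme.hsStratum W N ν)) (hZC : ¬ Z ⊆ (C.support : Set W))
    {Z' : Set ↥(blowup C)} (hZ' : Z' ∈ componentsIn (Scheme.hsStratum (blowup C) N ν))
    (hdom : closure ((blowup.π C).base '' Z') = Z) :
    Z' = strictTransformSet (blowup.π C) (C.support : Set W) Z := by
  have hE : IsClosed ((blowup.π C).base ⁻¹' (C.support : Set W)) :=
    C.support.isClosed.preimage (blowup.π C).continuous
  have hZ'irr : IsIrreducible Z' := componentsIn.isIrreducible hZ'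
  -- `Z'` has a point off `π⁻¹ V(C)` (else its image closure `Z` would lie in `V(C)`)
  have hne : (Z' ∩ ((blowup.π C).base ⁻¹' (C.support : Set W))ᶜ).Nonempty := by
    by_contra hc
    rw [Set.not_nonempty_iff_eq_empty, ← Set.sdiff_eq, Set.sdiff_eq_empty] at hc
    apply hZC
    rw [← hdom]
    refine closure_minimal ?_ C.support.isClosed
    rintro _ ⟨z, hz, rfl⟩
    exact hc hz
  -- `Z' ⊆ strict transform of Z`
  have hZ'T : Z' ⊆ strictTransformSet (blowup.π C) (C.support : Set W) Z := by
    have h1 : Z' ⊆ closure (Z' ∩ ((blowup.π C).base ⁻¹' (C.support : Set W))ᶜ) :=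
      subset_closure_inter_of_isPreirreducible_of_isOpen hZ'irr.isPreirreducible hE.isOpen_compl hne
    refine h1.trans (closure_mono ?_)
    rintro w ⟨hwZ, hwE⟩
    refine ⟨?_, hwE⟩
    rw [← hdom]
    exact subset_closure ⟨w, hwZ, rfl⟩
  -- the strict transform is irreducible and inside `Y'`, hence inside a component `Z₂ ⊇ Z'`, so all three coincide
  have hTirr : IsIrreducible (strictTransformSet (blowup.π C) (C.support : Set W) Z) :=
    isIrreducible_strictTransformSet_of_not_subset C (componentsIn.isIrreducible hZ) hZC
  have hTY' : strictTransformSet (blowup.π C) (C.support : Set W) Z ⊆ Scheme.hsStratum (blowup C) N ν :=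
    strictTransformSet_subset_hsStratum C (componentsIn.subset hZ) hY'
  obtain ⟨Z₂, hZ₂, hTZ₂⟩ := exists_componentsIn_superset hY' (componentsIn.finite _) hTirr hTY'
  have hZ₂Z' : Z₂ ⊆ Z' :=
    (mem_componentsIn_iff.mp hZ').2.2 Z₂ (componentsIn.subset hZ₂) (componentsIn.isIrreducible hZ₂) (hZ'T.trans hTZ₂)
  exact Set.Subset.antisymm hZ'T (hTZ₂.trans hZ₂Z')

/-- **A DOMINATING COMPONENT OFF THE CENTRE IS THE STRICT TRANSFORM**, read on a step projection `f : X_{n+1} ⟶ X_n` (the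
canonical centre `C` being that of THE canonical step, functional oracle): `Z' = closure f⁻¹(Z ∖ V(C))`.
[cite: GortzWedhorn2020, Prop. 13.91 (3), (13.19) p. 414] -/
theorem StepProjection.eq_strictTransformSet_of_closure_image_eq {k : Type u} [Field k] (hRf : OracleFunctional R)
    (hRa : OracleAdmissible R) (hν : ν ≠ iterPSum N Phi) {s s' : MarkedStage.{u}} (h : CycleInv k R N ν s)
    {f : s'.W ⟶ s.W} (hf : StepProjection R N ν s s' f) {C : s.W.IdealSheafData} {P' : Option (Pending (blowup C))}
    (hcs : IsCanonicalStep R N ν s.L s.P C P') {Z : Set s.W} (hZ : Z ∈ componentsIn (Scheme.hsStratum s.W N ν))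
    (hZC : ¬ Z ⊆ (C.support : Set s.W)) {Z' : Set s'.W} (hZ' : Z' ∈ componentsIn (Scheme.hsStratum s'.W N ν))
    (hdom : closure (f.base '' Z') = Z) :
    Z' = strictTransformSet f (C.support : Set s.W) Z := by
  have h' : CycleInv k R N ν s' := h.step hRa hν hf.canonicalNearStep
  obtain ⟨C₂, P₂, hln, x', hcs₂, hπ, hcl, hx', e, rfl⟩ := hf
  obtain rfl : C₂ = C := hcs₂.centre_unique hRf hcs
  subst e
  simp only [eqToHom_refl, Category.id_comp] at hdom ⊢
  haveI : IsLocallyNoetherian (blowup C₂) := hln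
  haveI : IsNoetherian (blowup C₂) := h'.isNoetherian
  haveI : IsNoetherian s.W := h.isNoetherian
  exact eq_strictTransformSet_blowup C₂ h'.isClosed_hsStratum hZ hZC hZ' hdom

/-- **UNIQUENESS OF THE DOMINANT OFF THE CENTRE**: two irreducible components of `X_{n+1}(ν)` dominating the same irreducible component
`Z ⊄ V(C)` of `X_n(ν)` coincide. [cite: GortzWedhorn2020, Prop. 13.91 (3)] -/
theorem StepProjection.dominant_unique {k : Type u} [Field k] (hRf : OracleFunctional R) (hRa : OracleAdmissible R)
    (hν : ν ≠ iterPSum N Phi) {s s' : MarkedStage.{u}} (h : CycleInv k R N ν s) {f : s'.W ⟶ s.W}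
    (hf : StepProjection R N ν s s' f) {C : s.W.IdealSheafData} {P' : Option (Pending (blowup C))}
    (hcs : IsCanonicalStep R N ν s.L s.P C P') {Z : Set s.W} (hZ : Z ∈ componentsIn (Scheme.hsStratum s.W N ν))
    (hZC : ¬ Z ⊆ (C.support : Set s.W)) {Z' Z'' : Set s'.W} (hZ' : Z' ∈ componentsIn (Scheme.hsStratum s'.W N ν))
    (hZ'' : Z'' ∈ componentsIn (Scheme.hsStratum s'.W N ν)) (hdom' : closure (f.base '' Z') = Z)
    (hdom'' : closure (f.base '' Z'') = Z) : Z' = Z'' := by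
  rw [hf.eq_strictTransformSet_of_closure_image_eq hRf hRa hν h hcs hZ hZC hZ' hdom',
    hf.eq_strictTransformSet_of_closure_image_eq hRf hRa hν h hcs hZ hZC hZ'' hdom'']

/-! ## §2. The uniqueness clause of (K-str), for every chain -/

/-- **THE UNIQUENESS HALF OF (K-str) HOLDS OUTRIGHT** (every origin predicate `Q`, every grade `G`, every stage; no regularity
hypothesis used): along a chain from a maximal origin, two components of `X_{n+1}(ν)` through `x_{n+1}` dominating the same component
`Z ∋ x_n` of `X_n(ν)` off the canonical centre are equal. [cite: GortzWedhorn2020, Prop. 13.91 (3)] -/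
theorem strataStrictTransformClean_uniqueness {p N : ℕ} (hRf : OracleFunctional R) (hRa : OracleAdmissible R)
    {X : Scheme.{u}} [IsLocallyNoetherian X] {x : X} (hX : IsMaximalOrigin p N ν X x) {c : ℕ → MarkedStage.{u}}
    (h0 : Reaches R N ν (MarkedStage.init X x) (c 0)) (hstep : ∀ n, CanonicalNearStep R N ν (c n) (c (n + 1))) (n : ℕ)
    {C : (c n).W.IdealSheafData} {P' : Option (Pending (blowup C))} (hcs : IsCanonicalStep R N ν (c n).L (c n).P C P')
    {f : (c (n + 1)).W ⟶ (c n).W} (hf : StepProjection R N ν (c n) (c (n + 1)) f)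
    {Z : Set (c n).W} (hZ : Z ∈ componentsThrough N ν (c n)) (hZC : ¬ Z ⊆ (C.support : Set (c n).W))
    {Z' Z'' : Set (c (n + 1)).W} (hZ' : Z' ∈ componentsThrough N ν (c (n + 1)))
    (hZ'' : Z'' ∈ componentsThrough N ν (c (n + 1))) (hdom' : closure (f.base '' Z') = Z)
    (hdom'' : closure (f.base '' Z'') = Z) : Z' = Z'' := by
  obtain ⟨hν, k, _, hinv⟩ := exists_cycleInv_chain' hRf hRa hX h0 hstep
  exact hf.dominant_unique hRf hRa hν (hinv n) hcs hZ.1 hZC hZ'.1 hZ''.1 hdom' hdom''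

end Summit.ResolutionOfSingularities.ResolutionOfSingularities.Theorems.SigmaMaxModificationsCorridor3.Moving

end
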